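import Literature.Algebra.Homology.KunnethMap
import Literature.Algebra.Homology.KunnethField
import HarnessLib

/-!
# The Künneth map is natural, and an isomorphism over a field (Weibel Thm. 3.6.3, canonical form)

Layer `Literature/Algebra/Homology` (sequel of `Algebra/Homology/KunnethMap`; one definition — the functoriality
`(H•(f), 0)` of the homology complex with zero differentials —, 0 named facts, no instances, no notation).

* §1 `homologyZeroDifferentialMap f : (H•(C), 0) ⟶ (H•(C'), 0)`; **naturality** of the Künneth components and of the
  Künneth map in both complexes: `kunnethComponent_naturality`, `kunnethMap_naturality`
  (`κ ≫ Hⁿ(f ⊗ g) = (H(f) ⊗ H(g))ⁿ ≫ κ`);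
* §2 complexes with ZERO differentials: `kunnethMap` is an isomorphism (`isIso_kunnethMap_of_d_eq_zero`; there every
  `π`, `ι` is invertible and `κ` is the identity of `∐ Kᵢ ⊗ Lⱼ` up to these);
* §3 **`isIso_kunnethMap`** — over a FIELD `k`, for bounded cochain complexes `C`, `D` of `k`-vector spaces the canonical
  Künneth map `κₙ : ∐_{i+j=n} Hⁱ(C) ⊗ Hʲ(D) ⟶ Hⁿ(C ⊗ D)` is an ISOMORPHISM (Weibel, *An introduction to homological
  algebra*, Thm. 3.6.3; Cartan–Eilenberg VI.3.1): transport along the quasi-isomorphisms `C → (H•(C), 0)`,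
  `D → (H•(D), 0)` of `Algebra/Homology/QuasiIsoToHomology` by naturality (the tensor product of the two is a
  quasi-isomorphism for bounded complexes, `Algebra/Homology/KunnethField`), and §2. This is the CANONICAL form of the
  tree's `KunnethField.nonempty_homology_tensorObj_iso` (which only asserted the existence of an isomorphism);
  `kunnethIso` packages it.

Everything is proved; no named fact. Library only (cell `pub-hodge-ring2`, count-neutral homological algebra; proves
nothing about any crux, route or conjecture).

-- TODO(general form): unbounded complexes (needs K-flatness of complexes of vector spaces) and the Künneth short exact
-- sequence with `Tor₁` over a PID (Weibel 3.6.3 as printed).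

## References

* C. A. Weibel, *An introduction to homological algebra* (1994), Thm. 3.6.3. [Weibel1994]
* H. Cartan, S. Eilenberg, *Homological Algebra* (1956), VI.3, Thm. 3.1. [CartanEilenberg1956]
-/

noncomputable section

-- `GradedObject`/`HomologicalComplex₂.toGradedObject` are not reducible (as in Mathlib's `Algebra/Homology/TotalComplex.lean`).
set_option backward.isDefEq.respectTransparency false

open CategoryTheory CategoryTheory.Category CategoryTheory.Limits CategoryTheory.MonoidalCategory HomologicalComplex

universe u

namespace Literature.Algebra.Homology

/-! ### §1 Naturality -/

section Naturality

variable {R : Type u} [CommRing R] {C C' D D' : CochainComplex (ModuleCat.{u} R) ℤ} (f : C ⟶ C') (g : D ⟶ D')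

/-- **`(H•(f), 0) : (H•(C), 0) ⟶ (H•(C'), 0)`**, the map induced on the homology complexes with zero differentials.
[cite: Weibel1994, Thm. 3.6.3] -/
def homologyZeroDifferentialMap : homologyZeroDifferential C ⟶ homologyZeroDifferential C' where
  f i := homologyMap f i
  comm' i j _ := by
    change homologyMap f i ≫ (0 : C'.homology i ⟶ C'.homology j) = (0 : C.homology i ⟶ C.homology j) ≫ homologyMap f j
    rw [comp_zero, zero_comp]

/-- Components of `(H•(f), 0)`. [cite: Weibel1994, Thm. 3.6.3] -/
@[simp]
theorem homologyZeroDifferentialMap_f (i : ℤ) : (homologyZeroDifferentialMap f).f i = homologyMap f i := rfl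

/-- `(H•(f), 0)` is an isomorphism for a quasi-isomorphism `f`. [cite: Weibel1994, Thm. 3.6.3] -/
theorem isIso_homologyZeroDifferentialMap [QuasiIso f] : IsIso (homologyZeroDifferentialMap f) := by
  haveI : ∀ i, IsIso ((homologyZeroDifferentialMap f).f i) := fun i => by
    rw [homologyZeroDifferentialMap_f, ← quasiIsoAt_iff_isIso_homologyMap]
    infer_instance
  exact Hom.isIso_of_components _

/-- `z ⊗ w ↦ z ⊗ w` is natural: `cyclesTensorToCycles ≫ Z(f ⊗ g) = (Z(f) ⊗ Z(g)) ≫ cyclesTensorToCycles`.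
[cite: Weibel1994, Thm. 3.6.3] -/
@[reassoc]
theorem cyclesTensorToCycles_naturality (i j n : ℤ) (h : i + j = n) :
    cyclesTensorToCycles C D i j n h ≫ cyclesMap (HomologicalComplex.tensorHom f g) n =
      (cyclesMap f i ⊗ₘ cyclesMap g j) ≫ cyclesTensorToCycles C' D' i j n h := by
  rw [← cancel_mono ((HomologicalComplex.tensorObj C' D').iCycles n), assoc, assoc, cyclesMap_i, cyclesTensorToCycles_i_assoc,
    cyclesTensorToCycles_i, cyclesTensorι, cyclesTensorι, assoc, ι_mapBifunctorMap, tensorHom_comp_tensorHom_assoc,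
    cyclesMap_i, cyclesMap_i, ← tensorHom_comp_tensorHom_assoc, tensorHom_def (f.f i) (g.f j), assoc]
  rfl

/-- **Naturality of the Künneth components**: `κᵢⱼ ≫ Hⁿ(f ⊗ g) = (Hⁱ(f) ⊗ Hʲ(g)) ≫ κᵢⱼ`.
[cite: Weibel1994, Thm. 3.6.3] [cite: CartanEilenberg1956, VI.3 Thm. 3.1] -/
theorem kunnethComponent_naturality (i j n : ℤ) (h : i + j = n) :
    kunnethComponent C D i j n h ≫ homologyMap (HomologicalComplex.tensorHom f g) n =
      (homologyMap f i ⊗ₘ homologyMap g j) ≫ kunnethComponent C' D' i j n h := by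
  apply hom_ext_homologyπ_tensor
  rw [← assoc, homologyπ_tensor_kunnethComponent, cyclesTensorToHomology, assoc, homologyπ_naturality,
    cyclesTensorToCycles_naturality_assoc, tensorHom_comp_tensorHom_assoc, homologyπ_naturality, homologyπ_naturality,
    ← tensorHom_comp_tensorHom_assoc, homologyπ_tensor_kunnethComponent, cyclesTensorToHomology]

/-- **Naturality of the Künneth map**: `κₙ ≫ Hⁿ(f ⊗ g) = ((H(f), 0) ⊗ (H(g), 0))ⁿ ≫ κₙ`.
[cite: Weibel1994, Thm. 3.6.3] [cite: CartanEilenberg1956, VI.3 Thm. 3.1] -/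
theorem kunnethMap_naturality (n : ℤ) :
    kunnethMap C D n ≫ homologyMap (HomologicalComplex.tensorHom f g) n =
      (HomologicalComplex.tensorHom (homologyZeroDifferentialMap f) (homologyZeroDifferentialMap g)).f n ≫ kunnethMap C' D' n := by
  apply mapBifunctor.hom_ext
  intro i j hij
  rw [ι_kunnethMap_assoc, ι_mapBifunctorMap_assoc, kunnethComponent_naturality]
  change _ = ((homologyMap f i ▷ _) ≫ (_ ◁ homologyMap g j)) ≫
    ιTensorObj (homologyZeroDifferential C') (homologyZeroDifferential D') i j n hij ≫ kunnethMap C' D' n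
  rw [← tensorHom_def, ι_kunnethMap]

end Naturality

/-! ### §1b Functoriality of `tensorHom` (composition, identities, isomorphisms) -/

section TensorHom

variable {R : Type u} [CommRing R]

/-- Functoriality of the tensor product of complexes in both variables (composition), on Mathlib's `tensorHom`.
[cite: Weibel1994, 2.7.1] -/
private theorem tensorHom_comp_tensorHom' {C₁ C₂ C₃ D₁ D₂ D₃ : CochainComplex (ModuleCat.{u} R) ℤ} (f₁ : C₁ ⟶ C₂)
    (f₂ : C₂ ⟶ C₃) (g₁ : D₁ ⟶ D₂) (g₂ : D₂ ⟶ D₃) :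
    HomologicalComplex.tensorHom f₁ g₁ ≫ HomologicalComplex.tensorHom f₂ g₂ =
      HomologicalComplex.tensorHom (f₁ ≫ f₂) (g₁ ≫ g₂) := by
  refine HomologicalComplex.hom_ext _ _ fun n => mapBifunctor.hom_ext fun i j hij => ?_
  rw [comp_f, ι_mapBifunctorMap_assoc, ι_mapBifunctorMap, ι_mapBifunctorMap]
  change (f₁.f i ▷ _) ≫ (_ ◁ g₁.f j) ≫ (f₂.f i ▷ _) ≫ (_ ◁ g₂.f j) ≫ _ =
    ((f₁.f i ≫ f₂.f i) ▷ _) ≫ (_ ◁ (g₁.f j ≫ g₂.f j)) ≫ _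
  rw [← tensorHom_def_assoc, ← tensorHom_def_assoc, ← tensorHom_def_assoc, tensorHom_comp_tensorHom_assoc]

/-- `tensorHom` of the identities is the identity. [cite: Weibel1994, 2.7.1] -/
private theorem tensorHom_id_id (C₁ D₁ : CochainComplex (ModuleCat.{u} R) ℤ) :
    HomologicalComplex.tensorHom (𝟙 C₁) (𝟙 D₁) = 𝟙 _ := by
  refine HomologicalComplex.hom_ext _ _ fun n => mapBifunctor.hom_ext fun i j hij => ?_
  rw [ι_mapBifunctorMap, id_f, id_f, id_f, comp_id, CategoryTheory.Functor.map_id, NatTrans.id_app,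
    CategoryTheory.Functor.map_id, id_comp, id_comp]

/-- `tensorHom` of two isomorphisms of complexes is an isomorphism. [cite: Weibel1994, 2.7.1] -/
private theorem isIso_tensorHom {C₁ C₂ D₁ D₂ : CochainComplex (ModuleCat.{u} R) ℤ} (φ : C₁ ⟶ C₂) (ψ : D₁ ⟶ D₂)
    [IsIso φ] [IsIso ψ] : IsIso (HomologicalComplex.tensorHom φ ψ) :=
  ⟨HomologicalComplex.tensorHom (inv φ) (inv ψ), by rw [tensorHom_comp_tensorHom', IsIso.hom_inv_id,
    IsIso.hom_inv_id, tensorHom_id_id], by rw [tensorHom_comp_tensorHom', IsIso.inv_hom_id, IsIso.inv_hom_id,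
    tensorHom_id_id]⟩

end TensorHom

/-! ### §2 Complexes with zero differentials -/

section ZeroDifferential

variable {R : Type u} [CommRing R] (K L : CochainComplex (ModuleCat.{u} R) ℤ)
  (hK : ∀ i j, K.d i j = 0) (hL : ∀ i j, L.d i j = 0)
include hK

/-- For a complex with zero differentials, `(H•(K), 0) ≅ K` (componentwise `Hⁱ ≅ Zⁱ ≅ Kⁱ`, Mathlib `isoHomologyπ`,
`iCyclesIso`). [cite: Weibel1994, Thm. 3.6.3 (proof)] -/
def homologyZeroDifferentialIsoOfDEqZero : homologyZeroDifferential K ≅ K :=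
  Hom.isoOfComponents (fun i => (K.isoHomologyπ (i - 1) i (by simp) (hK _ _)).symm ≪≫ K.iCyclesIso i (i + 1) (by simp) (hK _ _))
    (fun i j _ => by
      change _ ≫ K.d i j = (0 : K.homology i ⟶ K.homology j) ≫ _
      rw [hK, comp_zero, zero_comp])

/-- `π ≫ (the component of the isomorphism) = ι`. [cite: Weibel1994, Thm. 3.6.3 (proof)] -/
theorem homologyπ_homologyZeroDifferentialIsoOfDEqZero_hom_f (i : ℤ) :
    K.homologyπ i ≫ (homologyZeroDifferentialIsoOfDEqZero K hK).hom.f i = K.iCycles i := by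
  change K.homologyπ i ≫ (K.isoHomologyπ (i - 1) i (by simp) (hK _ _)).inv ≫
    (K.iCyclesIso i (i + 1) (by simp) (hK _ _)).hom = _
  rw [isoHomologyπ_hom_inv_id_assoc, iCyclesIso_hom]

include hL

/-- **For complexes with zero differentials the Künneth map is an isomorphism**: it is
`((H(K),0) ⊗ (H(L),0))ⁿ ≅ (K ⊗ L)ⁿ = Zⁿ(K ⊗ L) ≅ Hⁿ(K ⊗ L)` (the total complex has zero differentials,
`KunnethZeroDifferential.mapBifunctor_d_eq_zero`). [cite: Weibel1994, Thm. 3.6.3 (proof)] -/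
theorem isIso_kunnethMap_of_d_eq_zero (n : ℤ) : IsIso (kunnethMap K L n) := by
  have hT : ∀ m m', (HomologicalComplex.tensorObj K L).d m m' = 0 := mapBifunctor_d_eq_zero K L (curriedTensor _) _ hK hL
  let e₁ := homologyZeroDifferentialIsoOfDEqZero K hK
  let e₂ := homologyZeroDifferentialIsoOfDEqZero L hL
  let ic := (HomologicalComplex.tensorObj K L).iCyclesIso n (n + 1) (by simp) (hT _ _)
  haveI : IsIso ((HomologicalComplex.tensorObj K L).homologyπ n) := (HomologicalComplex.tensorObj K L).isIso_homologyπ (n - 1) n (by simp) (hT _ _)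
  have key : kunnethMap K L n = (HomologicalComplex.tensorHom e₁.hom e₂.hom).f n ≫ ic.inv ≫ (HomologicalComplex.tensorObj K L).homologyπ n := by
    apply mapBifunctor.hom_ext
    intro i j hij
    rw [ι_kunnethMap, ι_mapBifunctorMap_assoc]
    apply hom_ext_homologyπ_tensor
    rw [homologyπ_tensor_kunnethComponent, cyclesTensorToHomology]
    change _ = (K.homologyπ i ⊗ₘ L.homologyπ j) ≫ ((e₁.hom.f i ▷ _) ≫ (_ ◁ e₂.hom.f j)) ≫
      ιTensorObj K L i j n hij ≫ ic.inv ≫ (HomologicalComplex.tensorObj K L).homologyπ n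
    rw [← tensorHom_def, tensorHom_comp_tensorHom_assoc, homologyπ_homologyZeroDifferentialIsoOfDEqZero_hom_f,
      homologyπ_homologyZeroDifferentialIsoOfDEqZero_hom_f]
    have hc : cyclesTensorToCycles K L i j n hij = cyclesTensorι K L i j n hij ≫ ic.inv := by
      rw [← cancel_mono ((HomologicalComplex.tensorObj K L).iCycles n), cyclesTensorToCycles_i, assoc, iCyclesIso_inv_hom_id, comp_id]
    rw [hc, cyclesTensorι, assoc, assoc]
  haveI := isIso_tensorHom e₁.hom e₂.hom
  rw [key]
  infer_instance

end ZeroDifferential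

/-! ### §3 The Künneth isomorphism over a field -/

section Field

variable {k : Type u} [Field k] (C D : CochainComplex (ModuleCat.{u} k) ℤ)

/-- **The tensor product of the quasi-isomorphisms `C → (H•(C),0)`, `D → (H•(D),0)` is a quasi-isomorphism** for bounded
`C`, `D` over a field (`Cᵖ ⊗ –` and `– ⊗ Hᵖ(D)` are exact; the tree's `MapBifunctorQuasiIso`).
[cite: Weibel1994, Thm. 3.6.3 (proof)] -/
theorem quasiIso_tensorHom_of_bounded (a₁ b₁ a₂ b₂ : ℤ) [C.IsStrictlyGE a₁] [C.IsStrictlyLE b₁] [D.IsStrictlyGE a₂]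
    [D.IsStrictlyLE b₂] {C' D' : CochainComplex (ModuleCat.{u} k) ℤ} [D'.IsStrictlyGE a₂] [D'.IsStrictlyLE b₂]
    (φ : C ⟶ C') (ψ : D ⟶ D') [QuasiIso φ] [QuasiIso ψ] : QuasiIso (HomologicalComplex.tensorHom φ ψ) := by
  haveI h₁ : QuasiIso (mapBifunctorMap (𝟙 C) ψ (curriedTensor (ModuleCat.{u} k)) (ComplexShape.up ℤ)) :=
    quasiIso_mapBifunctorMap_id (curriedTensor (ModuleCat.{u} k)) ψ C a₁ b₁ fun p => quasiIso_map_tensorLeft (C.X p) ψ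
  haveI h₂ : QuasiIso (mapBifunctorMap φ (𝟙 D') (curriedTensor (ModuleCat.{u} k)) (ComplexShape.up ℤ)) :=
    quasiIso_mapBifunctorMap_id_right (curriedTensor (ModuleCat.{u} k)) φ D' a₂ b₂ fun p =>
      quasiIso_map_tensorRight _ φ
  have e : HomologicalComplex.tensorHom φ ψ =
      mapBifunctorMap (𝟙 C) ψ (curriedTensor (ModuleCat.{u} k)) (ComplexShape.up ℤ) ≫
        mapBifunctorMap φ (𝟙 D') (curriedTensor (ModuleCat.{u} k)) (ComplexShape.up ℤ) := by
    change _ = HomologicalComplex.tensorHom (𝟙 C) ψ ≫ HomologicalComplex.tensorHom φ (𝟙 D')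
    rw [tensorHom_comp_tensorHom', id_comp, comp_id]
  rw [e]
  infer_instance

/-- **The Künneth theorem over a field, canonical form** (Weibel Thm. 3.6.3; Cartan–Eilenberg VI.3.1): for bounded cochain
complexes `C`, `D` of `k`-vector spaces the Künneth map `κₙ : ∐_{i+j=n} Hⁱ(C) ⊗ Hʲ(D) ⟶ Hⁿ(C ⊗ D)`,
`[z] ⊗ [w] ↦ [z ⊗ w]`, is an ISOMORPHISM. [cite: Weibel1994, Thm. 3.6.3] [cite: CartanEilenberg1956, VI.3 Thm. 3.1] -/
theorem isIso_kunnethMap (a₁ b₁ a₂ b₂ : ℤ) [C.IsStrictlyGE a₁] [C.IsStrictlyLE b₁] [D.IsStrictlyGE a₂] [D.IsStrictlyLE b₂]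
    (n : ℤ) : IsIso (kunnethMap C D n) := by
  obtain ⟨ρC, hρC⟩ := exists_quasiIso_zeroDifferential_homology C
  obtain ⟨ρD, hρD⟩ := exists_quasiIso_zeroDifferential_homology D
  haveI := isStrictlyGE_zeroDifferential_homology D a₂
  haveI := isStrictlyLE_zeroDifferential_homology D b₂
  -- `Hⁿ(ρ_C ⊗ ρ_D)` is an isomorphism
  haveI := quasiIso_tensorHom_of_bounded C D a₁ b₁ a₂ b₂ ρC ρD
  haveI : IsIso (homologyMap (HomologicalComplex.tensorHom ρC ρD) n) := by
    rw [← quasiIsoAt_iff_isIso_homologyMap]; infer_instance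
  -- `((H(ρ_C),0) ⊗ (H(ρ_D),0))ⁿ` is an isomorphism
  haveI := isIso_homologyZeroDifferentialMap ρC
  haveI := isIso_homologyZeroDifferentialMap ρD
  haveI := isIso_tensorHom (homologyZeroDifferentialMap ρC) (homologyZeroDifferentialMap ρD)
  -- the Künneth map of the zero-differential complexes is an isomorphism
  haveI := isIso_kunnethMap_of_d_eq_zero (homologyZeroDifferential C) (homologyZeroDifferential D)
    (fun _ _ => rfl) (fun _ _ => rfl) n
  have hnat := kunnethMap_naturality ρC ρD n
  haveI : IsIso (kunnethMap C D n ≫ homologyMap (HomologicalComplex.tensorHom ρC ρD) n) := by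
    rw [hnat]; infer_instance
  exact IsIso.of_isIso_comp_right (kunnethMap C D n) (homologyMap (HomologicalComplex.tensorHom ρC ρD) n)

/-- **The Künneth isomorphism `∐_{i+j=n} Hⁱ(C) ⊗ Hʲ(D) ≅ Hⁿ(C ⊗ D)`** over a field, for bounded complexes — the
canonical isomorphism whose existence `KunnethField.nonempty_homology_tensorObj_iso` asserted.
[cite: Weibel1994, Thm. 3.6.3] [cite: CartanEilenberg1956, VI.3 Thm. 3.1] -/
def kunnethIso (a₁ b₁ a₂ b₂ : ℤ) [C.IsStrictlyGE a₁] [C.IsStrictlyLE b₁] [D.IsStrictlyGE a₂] [D.IsStrictlyLE b₂] (n : ℤ) :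
    (HomologicalComplex.tensorObj (homologyZeroDifferential C) (homologyZeroDifferential D)).X n ≅ (HomologicalComplex.tensorObj C D).homology n :=
  haveI := isIso_kunnethMap C D a₁ b₁ a₂ b₂ n
  asIso (kunnethMap C D n)

/-- The Künneth isomorphism restricted to the summand `Hⁱ(C) ⊗ Hʲ(D)` is the component `κᵢⱼ`, `[z] ⊗ [w] ↦ [z ⊗ w]`.
[cite: Weibel1994, Thm. 3.6.3] -/
theorem ι_kunnethIso_hom (a₁ b₁ a₂ b₂ : ℤ) [C.IsStrictlyGE a₁] [C.IsStrictlyLE b₁] [D.IsStrictlyGE a₂] [D.IsStrictlyLE b₂]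
    (i j n : ℤ) (h : i + j = n) :
    ιTensorObj (homologyZeroDifferential C) (homologyZeroDifferential D) i j n h ≫ (kunnethIso C D a₁ b₁ a₂ b₂ n).hom =
      kunnethComponent C D i j n h :=
  ι_kunnethMap C D i j n h

end Field

end Literature.Algebra.Homology

end
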